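import Summits.QuantumFields.YangMills.Theorems.UnitScaleTiltProp7GreenPiSupRowsOfLetters
import Summits.QuantumFields.YangMills.Theorems.UnitScaleTiltProp7GreenOneGradientRowOfLetters
import HarnessLib

/-!
# Route `UnitScaleTilt`, crux K1 «MinimiserStabilityRegPr» (stmt-QuantumFields-19200), EX row `norm_Hπ` — **(∇π)-KNIT: THE (115)-GRADIENT ROW OF `G_π`, LINEAR OVER ★p1's FOUR-TERM
# IDENTITY ✓`GT_pi_eq_four_terms`, AND THE hGπ-KNIT FOR `H_π = G_πQ_k†K_π⁻¹`** — the Π-slot twin of px17 g12's (∇1)-KNIT ✓`Prop7GreenOneGradientRowOfLetters.gradient_row_GTone_of_letters`,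
# consuming the SAME two gradient letters (∇0) `hG0` (✓`Prop7OneFormGreenBlockGradient.norm_nabla115_GT_le_of_sup`) and (H∇) `hHD`, so that the EX row `norm_Hπ`'s gradient half
# `hGπ` (✓`Prop7NormHpiOfKernel133.norm_Hπ_of_h133_of_gradFamily`'s letter) leaves the display modulo (H∇) and VALUE-class letters.
Cell `ym3-torus` (HUMAN RULING D-0037; rung R3 = SU(2) YM₃ on T³ — NOT d = 4, NOT infinite volume, NOT a mass gap, NOT Clay).  Width seat `ym3-torus-px21` (gen 15).
THEOREMS ONLY (0 `def`, 0 `sorry`, default heartbeats); `--supports stmt-QuantumFields-19200 --as helper`; count-neutral.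

THE MATHEMATICS ([Balaban1985BackgroundPropagators] (3.130)–(3.133) pp.421–422).  With `u := G_πf`, FILE C's identity reads `u = G₀f + G₀(Δ^η(Dλ₁)) + Dλ₂ − G₀(Δ^η(Dλ₂))`,
`λ₁ = G′ᴾR_SD*u`, `j = D*Δ^η(Pᴾu)`, `λ₂ = G′ᴾ(R_S(G′ᴾj))`, and `∇_{U₀} = nabla115 η (bgOfCfg U₀)` is `ℂ`-linear: so `∇u` is a signed sum of FOUR gradients, three of shape `∇G₀(source)`
((∇0) at a sup-bounded source) and one `∇(Dλ₂)` ((H∇) at `v := toL2S⁻¹ j`).  The sources are sup-bounded by FILE C's own rows: (Vπ)∕(Divπ) `≤ 2(BV+BD)·s`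
(✓`valueDiv_rows_GTpi_of_letters`), (C-val) `|Δ^η(Dλ)| ≤ 4α|λ|` and (C-div) `|D*Δ^ηy| ≤ 12α|y|` (✓`Prop7CurrentPairingPointwise`), (c1)(c2)(c3), `Pᴾu = u − Dλ₁`, `R_SR_S = R_S`.

WHAT IS PROVED (ns `Summit.QuantumFields.YangMills.Theorems.Prop7GreenPiGradientRowOfLetters`; member `F n K`, `h : n ≤ K`, weights `c₀ cB`, coupling `0 ≤ a`).
* §0 `norm_fourTerms_le` (the shape of the four-term identity).
* §1 ★★★ `gradient_row_GTpi_of_letters` — at `RegPr F n K α U₀`, `0 ≤ a`, `PosOnto` at `DeltaEtaSlot` and at `DeltaPiSlotP a`, from FILE C's letters VERBATIM {`hV`, `hDiv`, `hc1`, `hc2`, `hc3`,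
  `hwin`} and px17's two gradient letters VERBATIM {(∇0) `hG0`, (H∇) `hHD`}: `∀ X s, (∀ b, ‖X b‖ ≤ s) →
  ‖nabla115 ((L⁻¹)^(K−n)) (bgOfCfg F K U₀) (fun q => toL2⁻¹(G_π(toL2 X)) (bondEquiv⁻¹ q))‖ ≤ (BG·(1 + 8αC₁(BV+BD) + 96α²C₁C₃(1+C₂)(BV+BD)) + BH·24α(1+C₂)(BV+BD))·s`
  (T0 `BG`; T1 `BG·4α·C₁·2(BV+BD)` by (C-val)∘(c1) at `v := toL2S⁻¹(D*u)`; T2 `BH·12α(1+C₂)·2(BV+BD)` by (H∇) at `v := toL2S⁻¹j`, (C-div), `Pᴾu = u − Dλ₁`, (c2); T3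
  `BG·4α·C₁C₃·12α(1+C₂)·2(BV+BD)` by (C-val)∘(c1)∘`R_SR_S`∘(c3)) — LINEAR bookkeeping, no second window.
* §2 ★★ `gradient_row_HT_of_gradient_row` — SLOT-GENERIC in `Δx` (px17 g12's request): on `PosOnto … Δx U₀`, a gradient sup row of `G = GT … Δx U₀` (`BGx`), the `Q_k†` sup row
  (✓`Prop7QTwSColumnBound.norm_toL2_symm_adjoint_Qk_apply_le_of_regPr`'s shape, `0 ≤ CQ`) and a sup row of `K⁻¹ = KinvT … Δx U₀` (`CK`) give the gradient row of `H = GQ_k†K⁻¹`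
  (✓`HT_eq_comp`) with `BGx·CQ·CK` — so `hGπ` is its `Δ_πᴾ` edition over §1 and `norm_H₁`'s ∇-half its `Δ₁` edition over px17's ✓`gradient_row_GTone_of_letters`.
* §3 ★★★ `gradient_row_HTpi_of_letters` — §2 at `DeltaPiSlotP a` over §1 ⟹ **the Hπ-DOOR's `hGπ` member text**
  `∀ b, ‖nabla115 ((L⁻¹)^(K−n)) (bgOfCfg F K U₀) (fun q => toL2⁻¹(HT … (DeltaPiSlotP … a) U₀ (toL2B b)) (bondEquiv⁻¹ q))‖ ≤ (BGπ·(CQ·CK))·‖b‖` (K-free as a PRODUCT: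
  `CQ ∝ (cB∕c₀)ℓ⁻³`, `CK ∝ (c₀∕cB)ℓ³` — the H-DOOR's bookkeeping).
HYP-SAT (★★OWNER RULING №42): `RegPr` inhabited by EX's minimiser; `PosOnto` ×2 ⟸ (γ) ✓`hco_DeltaEtaSlot_exists` ∕ the Π-slot class of record; `hV` ⟸ N4 ✓`Prop7OneFormGreenSupBound`,
`hDiv` ⟸ (Db) ✓p770568 summed (✓`weighted_of_blockSupported` at rate 0), (c1)(c2)(c3) ⟸ px5's (c)-package, `hwin` = FILE C's α-window, (∇0) ⟸ ✓p774397 §3 (LANDED), (H∇) ⟸ px17 g12's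
⧗`…ChainPotentialHessianRow`, (Q†) ⟸ ✓`norm_toL2_symm_adjoint_Qk_apply_le_of_regPr`, (K1π) ⟸ the K-storey `hKinv(Π)` row summed; every letter a linear sup row — non-vacuous, no `Prop` placeholder.
HONEST SCOPE.  Bookkeeping over displayed letters; nothing of (H∇), the K-storey, `h133`, `norm_Hπ`, the 8 EX rows, EX or the crux is proved here; no summit is proved by a helper.
References: T. Bałaban, CMP **99** (1985) 389–434 [Balaban1985BackgroundPropagators] ((3.3) p.391, (3.117)–(3.119) p.419, (3.122)–(3.126) p.420, (3.130)–(3.133) pp.421–422,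
Thm 3.12 p.423); CMP **102** (1985) 277–309 [Balaban1985Variational] ((19) p.281, (45)–(46) p.285, (115)–(117) pp.294–295).
-/

set_option autoImplicit false

noncomputable section

open scoped BigOperators Matrix.Norms.L2Operator InnerProductSpace ComplexConjugate

namespace Summit.QuantumFields.YangMills.Theorems.Prop7GreenPiGradientRowOfLetters

open Literature.MathematicalPhysics.QuantumFieldTheory.Balaban1983to89
open Literature.MathematicalPhysics.QuantumFieldTheory.Balaban1983to89.T3ContinuumYM3Torus
open T3PrintedRegularMinimiser (RegPr)
open T3SectALandauChart (eta eta_pos)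
open B9SectCLatticeCarrier (Bond)
open B9Eq311L2Pairing (WL2)
open B11Eq111FrakG (nabla115)
open B11Eq103H1Complex (SiteL2K BondL2K)
open Summit.QuantumFields.YangMills.Theorems.Prop7SectET3Transport (periodsT3 bondEquiv bgOfCfg)
open Summit.QuantumFields.YangMills.Theorems.Prop7SectET3HilbertLetters (W₂ toL2 toL2S toL2B DL2 DstarL2)
open Summit.QuantumFields.YangMills.Theorems.Prop7SectET3GaugeProjector (NS RS RS_RS)
open Summit.QuantumFields.YangMills.Theorems.Prop7SectET3WilsonHessian (DeltaEta DeltaEtaSlot)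
open Summit.QuantumFields.YangMills.Theorems.Prop7SectET3CurvedPropagators (Qk PosOnto GT HT KinvT HT_eq_comp)
open Summit.QuantumFields.YangMills.Theorems.Prop7SectET3DeltaPiPInv (GprimeP gaugeCorrP DeltaPiSlotP gaugeCorrP_apply)
open Summit.QuantumFields.YangMills.Theorems.Prop7CurrentPairingPointwise (norm_symm_DeltaEta_DL2_toL2S_apply_le_of_sup norm_symm_DstarL2_DeltaEta_toL2_apply_le)
open Summit.QuantumFields.YangMills.Theorems.Prop7GreenPiSupRowsOfLetters (GT_pi_eq_four_terms valueDiv_rows_GTpi_of_letters)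
open Summit.QuantumFields.YangMills.Theorems.Prop7GreenOneGradientRowOfLetters (exists_gradReader)

/-! ## §0 The abstract four-term triangle inequality -/

/-- `‖t₀ + t₁ + (t₂ − t₃)‖ ≤ ‖t₀‖ + ‖t₁‖ + ‖t₂‖ + ‖t₃‖` — the shape of FILE C's four-term identity. [cite: Balaban1985BackgroundPropagators, (3.130) p.421] -/
theorem norm_fourTerms_le {E : Type*} [SeminormedAddCommGroup E] (t₀ t₁ t₂ t₃ : E) :
    ‖t₀ + t₁ + (t₂ - t₃)‖ ≤ ‖t₀‖ + ‖t₁‖ + ‖t₂‖ + ‖t₃‖ := by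
  have h1 := norm_add_le (t₀ + t₁) (t₂ - t₃)
  have h2 := norm_add_le t₀ t₁
  have h3 := norm_sub_le t₂ t₃
  linarith

variable {F : T3Family} {n K : ℕ} {h : n ≤ K} {c₀ cB a : ℝ} [Fact (0 < c₀)] [Fact (0 < cB)]

/-! ## §1 ★★★ (∇π): the (115)-gradient row of `G_π` from the letters -/

/-- ★★★ **(∇π) = THE (115)-GRADIENT ROW OF `G_π` FROM VALUE-CLASS LETTERS AND THE TWO GRADIENT LETTERS (∇0), (H∇).**  At `U₀ ∈ RegPr α`, `0 ≤ a`, on the classes at the slots `Δ^η` and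
`Δ_πᴾ`, given FILE C's letters — (V)∕(Div) the VALUE and DIVERGENCE sup rows of `G₀` (`BV`, `BD`), (c1)(c2)(c3) the scalar-storey letters, the α-window `hwin` — and px17 g12's (∇0) `hG0`
(`BG`) and (H∇) `hHD` (`BH`) VERBATIM: for every source `X` with `‖X b‖ ≤ s`,
`‖∇_{U₀}(toL2⁻¹(G_π(toL2 X)) ∘ bondEquiv⁻¹)‖ ≤ (BG·(1 + 8αC₁(BV+BD) + 96α²C₁C₃(1+C₂)(BV+BD)) + BH·24α(1+C₂)(BV+BD))·s` — LINEAR bookkeeping over ✓`GT_pi_eq_four_terms` with the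
sources bounded by ✓`valueDiv_rows_GTpi_of_letters`, (C-val) `4α`, (C-div) `12α`, `Pᴾu = u − Dλ₁`, `R_SR_S = R_S`; no second window.
[cite: Balaban1985BackgroundPropagators, (3.130)–(3.133) pp.421–422, (3.117)–(3.119) p.419, (3.122) p.420, Thm 3.12 p.423; Balaban1985Variational, (19) p.281, (115)–(117) pp.294–295] -/
theorem gradient_row_GTpi_of_letters {α : ℝ} (U₀ : GaugeField (F.P K) 0 (Matrix.specialUnitaryGroup (Fin 2) ℂ)) (hreg : RegPr F n K α U₀) (ha : 0 ≤ a)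
    (hp₀ : PosOnto F n K h c₀ cB a (DeltaEtaSlot F n K c₀) U₀) (hpπ : PosOnto F n K h c₀ cB a (DeltaPiSlotP F n K h c₀ cB a) U₀)
    {BV BD C₁ C₂ C₃ BG BH : ℝ} (hBV : 0 ≤ BV) (hBD : 0 ≤ BD) (hC₁ : 0 ≤ C₁) (hC₂ : 0 ≤ C₂) (hC₃ : 0 ≤ C₃)
    (hV : ∀ (X : PBond (F.P K) 0 → Matrix (Fin 2) (Fin 2) ℂ) (s : ℝ), (∀ b, ‖X b‖ ≤ s) →
      ∀ b, ‖(toL2 F K c₀).symm (GT F n K h c₀ cB a (DeltaEtaSlot F n K c₀) U₀ (toL2 F K c₀ X)) b‖ ≤ BV * s)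
    (hDiv : ∀ (X : PBond (F.P K) 0 → Matrix (Fin 2) (Fin 2) ℂ) (s : ℝ), (∀ b, ‖X b‖ ≤ s) →
      ∀ x, ‖(toL2S F K c₀).symm (DstarL2 F n K c₀ U₀ (GT F n K h c₀ cB a (DeltaEtaSlot F n K c₀) U₀ (toL2 F K c₀ X))) x‖ ≤ BD * s)
    (hc1 : ∀ (v : Site (F.P K) 0 → Matrix (Fin 2) (Fin 2) ℂ) (m : ℝ), (∀ x, ‖v x‖ ≤ m) →
      ∀ x, ‖(toL2S F K c₀).symm (GprimeP F n K h c₀ cB a U₀ (RS F n K h c₀ cB U₀ (toL2S F K c₀ v))) x‖ ≤ C₁ * m)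
    (hc2 : ∀ (v : Site (F.P K) 0 → Matrix (Fin 2) (Fin 2) ℂ) (m : ℝ), (∀ x, ‖v x‖ ≤ m) →
      ∀ b, ‖(toL2 F K c₀).symm (DL2 F n K c₀ U₀ (GprimeP F n K h c₀ cB a U₀ (RS F n K h c₀ cB U₀ (toL2S F K c₀ v)))) b‖ ≤ C₂ * m)
    (hc3 : ∀ (v : Site (F.P K) 0 → Matrix (Fin 2) (Fin 2) ℂ) (m : ℝ), (∀ x, ‖v x‖ ≤ m) →
      ∀ x, ‖(toL2S F K c₀).symm (RS F n K h c₀ cB U₀ (GprimeP F n K h c₀ cB a U₀ (toL2S F K c₀ v))) x‖ ≤ C₃ * m)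
    (hwin : 4 * α * C₁ * (BV + BD) + 12 * α * C₃ * (1 + C₂) * (1 + C₂ + 4 * α * C₁ * (BV + BD)) ≤ 1 / 2)
    (hG0 : ∀ (X : PBond (F.P K) 0 → Matrix (Fin 2) (Fin 2) ℂ) (s : ℝ), (∀ b, ‖X b‖ ≤ s) →
      ‖nabla115 (((F.L : ℝ)⁻¹) ^ (K - n)) (bgOfCfg F K U₀)
          (fun q : Bond 3 (periodsT3 F K) => (toL2 F K c₀).symm (GT F n K h c₀ cB a (DeltaEtaSlot F n K c₀) U₀ (toL2 F K c₀ X)) ((bondEquiv F K).symm q))‖ ≤ BG * s)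
    (hHD : ∀ (v : Site (F.P K) 0 → Matrix (Fin 2) (Fin 2) ℂ) (m : ℝ), (∀ x, ‖v x‖ ≤ m) →
      ‖nabla115 (((F.L : ℝ)⁻¹) ^ (K - n)) (bgOfCfg F K U₀)
          (fun q : Bond 3 (periodsT3 F K) => (toL2 F K c₀).symm (DL2 F n K c₀ U₀ (GprimeP F n K h c₀ cB a U₀ (RS F n K h c₀ cB U₀
            (GprimeP F n K h c₀ cB a U₀ (toL2S F K c₀ v))))) ((bondEquiv F K).symm q))‖ ≤ BH * m) :
    ∀ (X : PBond (F.P K) 0 → Matrix (Fin 2) (Fin 2) ℂ) (s : ℝ), (∀ b, ‖X b‖ ≤ s) →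
      ‖nabla115 (((F.L : ℝ)⁻¹) ^ (K - n)) (bgOfCfg F K U₀)
          (fun q : Bond 3 (periodsT3 F K) =>
            (toL2 F K c₀).symm (GT F n K h c₀ cB a (DeltaPiSlotP F n K h c₀ cB a) U₀ (toL2 F K c₀ X)) ((bondEquiv F K).symm q))‖
        ≤ (BG * (1 + 8 * α * C₁ * (BV + BD) + 96 * α ^ 2 * C₁ * C₃ * (1 + C₂) * (BV + BD)) + BH * (24 * α * (1 + C₂) * (BV + BD))) * s := by
  intro X s hX
  obtain ⟨Γ, hΓ⟩ := exists_gradReader (n := n) (c₀ := c₀) U₀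
  -- FILE C's value and divergence rows of `G_π` at this source
  obtain ⟨hVπ, hDπ⟩ := valueDiv_rows_GTpi_of_letters (h := h) (cB := cB) U₀ hreg ha hp₀ hpπ hBV hBD hC₁ hC₂ hC₃ hV hDiv hc1 hc2 hc3 hwin X hX
  -- the four-term identity (before the abbreviations)
  have h4 := GT_pi_eq_four_terms (h := h) (cB := cB) ha hp₀ hpπ (toL2 F K c₀ X)
  -- the objects
  set f := toL2 F K c₀ X with hf
  set u := GT F n K h c₀ cB a (DeltaPiSlotP F n K h c₀ cB a) U₀ f with hu
  set lam₁ := GprimeP F n K h c₀ cB a U₀ (RS F n K h c₀ cB U₀ (DstarL2 F n K c₀ U₀ u)) with hlam₁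
  set j := DstarL2 F n K c₀ U₀ (DeltaEta F n K c₀ U₀ (gaugeCorrP F n K h c₀ cB a U₀ u)) with hj
  set lam₂ := GprimeP F n K h c₀ cB a U₀ (RS F n K h c₀ cB U₀ (GprimeP F n K h c₀ cB a U₀ j)) with hlam₂
  set G₀ := GT F n K h c₀ cB a (DeltaEtaSlot F n K c₀) U₀ with hG₀
  -- the goal is `‖Γ u‖`
  rw [← hΓ u]
  have hΓu : Γ u = Γ (G₀ f) + Γ (G₀ (DeltaEta F n K c₀ U₀ (DL2 F n K c₀ U₀ lam₁)))
      + (Γ (DL2 F n K c₀ U₀ lam₂) - Γ (G₀ (DeltaEta F n K c₀ U₀ (DL2 F n K c₀ U₀ lam₂)))) := by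
    have e := congrArg Γ h4
    simpa only [map_add, map_sub] using e
  -- the readers in Hilbert-source currency
  have hread : ∀ y : BondL2K ℂ 3 (periodsT3 F K) c₀ W₂, y = toL2 F K c₀ ((toL2 F K c₀).symm y) := fun y => (LinearEquiv.apply_symm_apply _ _).symm
  have hreadS : ∀ g : SiteL2K ℂ 3 (periodsT3 F K) c₀ W₂, g = toL2S F K c₀ ((toL2S F K c₀).symm g) := fun g => (LinearEquiv.apply_symm_apply _ _).symm
  -- (∇0) on a Hilbert-level source
  have hG0' : ∀ (y : BondL2K ℂ 3 (periodsT3 F K) c₀ W₂) (m : ℝ), (∀ b, ‖(toL2 F K c₀).symm y b‖ ≤ m) → ‖Γ (G₀ y)‖ ≤ BG * m := by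
    intro y m hm
    have e := hG0 ((toL2 F K c₀).symm y) m hm
    rw [← hread y] at e
    rw [hΓ]
    exact e
  -- (Vπ)∕(Divπ)
  have hUb : ∀ b, ‖(toL2 F K c₀).symm u b‖ ≤ 2 * (BV + BD) * s := fun b => hVπ b
  set V : Site (F.P K) 0 → Matrix (Fin 2) (Fin 2) ℂ := (toL2S F K c₀).symm (DstarL2 F n K c₀ U₀ u) with hVd
  have hVx : ∀ x, ‖V x‖ ≤ 2 * (BV + BD) * s := fun x => hDπ x
  -- (c1)(c2) on `λ₁ = G′ᴾR_S(toL2S V)`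
  have hVeq : toL2S F K c₀ V = DstarL2 F n K c₀ U₀ u := LinearEquiv.apply_symm_apply _ _
  have hlam₁V : lam₁ = GprimeP F n K h c₀ cB a U₀ (RS F n K h c₀ cB U₀ (toL2S F K c₀ V)) := by rw [hVeq]
  have hl₁ : ∀ x, ‖(toL2S F K c₀).symm lam₁ x‖ ≤ C₁ * (2 * (BV + BD) * s) := fun x => by rw [hlam₁V]; exact hc1 V _ hVx x
  have hDl₁ : ∀ b, ‖(toL2 F K c₀).symm (DL2 F n K c₀ U₀ lam₁) b‖ ≤ C₂ * (2 * (BV + BD) * s) := fun b => by rw [hlam₁V]; exact hc2 V _ hVx b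
  -- (C-val) on the defect sources `Δ^η(Dλ)`
  have hsrc : ∀ (lam : SiteL2K ℂ 3 (periodsT3 F K) c₀ W₂) (m : ℝ), (∀ x, ‖(toL2S F K c₀).symm lam x‖ ≤ m) →
      ∀ b, ‖(toL2 F K c₀).symm (DeltaEta F n K c₀ U₀ (DL2 F n K c₀ U₀ lam)) b‖ ≤ 4 * α * m := by
    intro lam m hm b
    rw [hreadS lam]
    exact norm_symm_DeltaEta_DL2_toL2S_apply_le_of_sup U₀ hreg _ hm b
  -- `Pᴾu = u − Dλ₁` pointwise
  set Pu : PBond (F.P K) 0 → Matrix (Fin 2) (Fin 2) ℂ := (toL2 F K c₀).symm (gaugeCorrP F n K h c₀ cB a U₀ u) with hPu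
  have hPu_le : ∀ b, ‖Pu b‖ ≤ 2 * (BV + BD) * s + C₂ * (2 * (BV + BD) * s) := by
    intro b
    have e : Pu b = (toL2 F K c₀).symm u b - (toL2 F K c₀).symm (DL2 F n K c₀ U₀ lam₁) b := by
      rw [hPu, gaugeCorrP_apply, map_sub, Pi.sub_apply]
    rw [e]
    exact (norm_sub_le _ _).trans (add_le_add (hUb b) (hDl₁ b))
  have hPueq : toL2 F K c₀ Pu = gaugeCorrP F n K h c₀ cB a U₀ u := LinearEquiv.apply_symm_apply _ _
  -- (C-div) on `j = D*Δ^η(Pᴾu)`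
  have hjle : ∀ x, ‖(toL2S F K c₀).symm j x‖ ≤ 12 * α * (2 * (BV + BD) * s + C₂ * (2 * (BV + BD) * s)) := by
    intro x
    rw [hj, ← hPueq]
    exact norm_symm_DstarL2_DeltaEta_toL2_apply_le U₀ hreg Pu hPu_le x
  -- the chain `j ↦ R_SG′ᴾj ↦ λ₂ = G′ᴾR_SG′ᴾj` through (c3)(c1), and (H∇) on `Dλ₂`
  set Jv : Site (F.P K) 0 → Matrix (Fin 2) (Fin 2) ℂ := (toL2S F K c₀).symm j with hJv
  have hJveq : toL2S F K c₀ Jv = j := LinearEquiv.apply_symm_apply _ _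
  have hg : ∀ x, ‖(toL2S F K c₀).symm (RS F n K h c₀ cB U₀ (GprimeP F n K h c₀ cB a U₀ j)) x‖ ≤ C₃ * (12 * α * (2 * (BV + BD) * s + C₂ * (2 * (BV + BD) * s))) :=
    fun x => by rw [← hJveq]; exact hc3 Jv _ hjle x
  set Gv : Site (F.P K) 0 → Matrix (Fin 2) (Fin 2) ℂ := (toL2S F K c₀).symm (RS F n K h c₀ cB U₀ (GprimeP F n K h c₀ cB a U₀ j)) with hGv
  have hGveq : toL2S F K c₀ Gv = RS F n K h c₀ cB U₀ (GprimeP F n K h c₀ cB a U₀ j) := LinearEquiv.apply_symm_apply _ _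
  have hlamG : lam₂ = GprimeP F n K h c₀ cB a U₀ (RS F n K h c₀ cB U₀ (toL2S F K c₀ Gv)) := by
    rw [hlam₂, hGveq, RS_RS]
  have hl₂ : ∀ x, ‖(toL2S F K c₀).symm lam₂ x‖ ≤ C₁ * (C₃ * (12 * α * (2 * (BV + BD) * s + C₂ * (2 * (BV + BD) * s)))) :=
    fun x => by rw [hlamG]; exact hc1 Gv _ hg x
  have hΓDl₂ : ‖Γ (DL2 F n K c₀ U₀ lam₂)‖ ≤ BH * (12 * α * (2 * (BV + BD) * s + C₂ * (2 * (BV + BD) * s))) := by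
    have e := hHD Jv _ hjle
    rw [hJveq] at e
    rw [hΓ]
    exact e
  -- the four gradients
  have T0 : ‖Γ (G₀ f)‖ ≤ BG * s := hG0' f s fun b => by
    rw [hf, LinearEquiv.symm_apply_apply]; exact hX b
  have T1 : ‖Γ (G₀ (DeltaEta F n K c₀ U₀ (DL2 F n K c₀ U₀ lam₁)))‖ ≤ BG * (4 * α * (C₁ * (2 * (BV + BD) * s))) := hG0' _ _ (hsrc lam₁ _ hl₁)
  have T2 : ‖Γ (DL2 F n K c₀ U₀ lam₂)‖ ≤ BH * (12 * α * (2 * (BV + BD) * s + C₂ * (2 * (BV + BD) * s))) := hΓDl₂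
  have T3 : ‖Γ (G₀ (DeltaEta F n K c₀ U₀ (DL2 F n K c₀ U₀ lam₂)))‖ ≤ BG * (4 * α * (C₁ * (C₃ * (12 * α * (2 * (BV + BD) * s + C₂ * (2 * (BV + BD) * s)))))) :=
    hG0' _ _ (hsrc lam₂ _ hl₂)
  -- assemble
  rw [hΓu]
  refine (norm_fourTerms_le _ _ _ _).trans ?_
  have htot : BG * s + BG * (4 * α * (C₁ * (2 * (BV + BD) * s))) + BH * (12 * α * (2 * (BV + BD) * s + C₂ * (2 * (BV + BD) * s)))
      + BG * (4 * α * (C₁ * (C₃ * (12 * α * (2 * (BV + BD) * s + C₂ * (2 * (BV + BD) * s))))))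
      = (BG * (1 + 8 * α * C₁ * (BV + BD) + 96 * α ^ 2 * C₁ * C₃ * (1 + C₂) * (BV + BD)) + BH * (24 * α * (1 + C₂) * (BV + BD))) * s := by ring
  linarith [T0, T1, T2, T3, htot]

/-! ## §2 ★★ The `H = G∘Q_k†∘K⁻¹` gradient composition, SLOT-GENERIC -/

omit [Fact (0 < c₀)] [Fact (0 < cB)] in
/-- `0 ≤ C·‖b‖` read off a pointwise coarse row at one coarse bond. [folklore] -/
theorem nonneg_of_coarseRow {C : ℝ} {b : PBond (F.P n) 0 → Matrix (Fin 2) (Fin 2) ℂ} {g : WL2 ℂ (fun _ : PBond (F.P n) 0 => cB) W₂}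
    (hg : ∀ c, ‖(toL2B F n cB).symm g c‖ ≤ C * ‖b‖) : 0 ≤ C * ‖b‖ :=
  (norm_nonneg _).trans (hg ⟨Classical.arbitrary _, 0⟩)

/-- ★★ **THE GRADIENT ROW OF `H = GQ_k†K⁻¹` FROM THAT OF `G`, AT ANY HESSIAN SLOT `Δx`** (px17 g12's request: `hGπ` (slot `Δ_πᴾ`) and `norm_H₁`'s ∇-half (slot `Δ₁ = Pᴾ†(Δ^η+T_J)Pᴾ`) are
two editions of ONE composition): on the class `PosOnto … Δx U₀` (✓`HT_eq_comp`: `H = G ∘ Q_k† ∘ K⁻¹`), a gradient sup row `hGx` of `G = GT … Δx U₀` on sup-bounded sources (`BGx`), the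
`Q_k†` sup row `hQa` (✓`Prop7QTwSColumnBound.norm_toL2_symm_adjoint_Qk_apply_le_of_regPr`'s shape, `0 ≤ CQ`) and a sup row `hKinv` of `K⁻¹ = KinvT … Δx U₀` (`CK`) give
`∀ b, ‖∇_{U₀}(toL2⁻¹(H(toL2B b)) ∘ bondEquiv⁻¹)‖ ≤ (BGx·(CQ·CK))·‖b‖`.
[cite: Balaban1985BackgroundPropagators, (3.126) p.420, (3.129) p.421, (3.133) p.422; Balaban1985Variational, (45)–(46) p.285, (103) p.293, (115) p.294] -/
theorem gradient_row_HT_of_gradient_row (U₀ : GaugeField (F.P K) 0 (Matrix.specialUnitaryGroup (Fin 2) ℂ))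
    (Δx : GaugeField (F.P K) 0 (Matrix.specialUnitaryGroup (Fin 2) ℂ) → (BondL2K ℂ 3 (periodsT3 F K) c₀ W₂ →ₗ[ℂ] BondL2K ℂ 3 (periodsT3 F K) c₀ W₂))
    (hp : PosOnto F n K h c₀ cB a Δx U₀) {BGx CQ CK : ℝ} (hCQ : 0 ≤ CQ)
    (hGx : ∀ (X : PBond (F.P K) 0 → Matrix (Fin 2) (Fin 2) ℂ) (s : ℝ), (∀ b, ‖X b‖ ≤ s) →
      ‖nabla115 (((F.L : ℝ)⁻¹) ^ (K - n)) (bgOfCfg F K U₀)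
          (fun q : Bond 3 (periodsT3 F K) => (toL2 F K c₀).symm (GT F n K h c₀ cB a Δx U₀ (toL2 F K c₀ X)) ((bondEquiv F K).symm q))‖ ≤ BGx * s)
    (hQa : ∀ (Y : PBond (F.P n) 0 → Matrix (Fin 2) (Fin 2) ℂ) (bd : PBond (F.P K) 0),
      ‖(toL2 F K c₀).symm (LinearMap.adjoint (Qk F n K h c₀ cB U₀) (toL2B F n cB Y)) bd‖ ≤ CQ * ‖Y‖)
    (hKinv : ∀ (b : PBond (F.P n) 0 → Matrix (Fin 2) (Fin 2) ℂ) (c : PBond (F.P n) 0),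
      ‖(toL2B F n cB).symm (KinvT F n K h c₀ cB a Δx U₀ (toL2B F n cB b)) c‖ ≤ CK * ‖b‖)
    (b : PBond (F.P n) 0 → Matrix (Fin 2) (Fin 2) ℂ) :
    ‖nabla115 (((F.L : ℝ)⁻¹) ^ (K - n)) (bgOfCfg F K U₀)
        (fun q : Bond 3 (periodsT3 F K) =>
          (toL2 F K c₀).symm (HT F n K h c₀ cB a Δx U₀ (toL2B F n cB b)) ((bondEquiv F K).symm q))‖ ≤ (BGx * (CQ * CK)) * ‖b‖ := by
  -- the coarse field `Y := K⁻¹b` and the fine source `X := Q_k†Y`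
  set Y : PBond (F.P n) 0 → Matrix (Fin 2) (Fin 2) ℂ := (toL2B F n cB).symm (KinvT F n K h c₀ cB a Δx U₀ (toL2B F n cB b)) with hY
  have hYeq : toL2B F n cB Y = KinvT F n K h c₀ cB a Δx U₀ (toL2B F n cB b) := LinearEquiv.apply_symm_apply _ _
  have hYn : ‖Y‖ ≤ CK * ‖b‖ := (pi_norm_le_iff_of_nonneg (nonneg_of_coarseRow (F := F) (cB := cB) (hKinv b))).2 fun c => hKinv b c
  set X : PBond (F.P K) 0 → Matrix (Fin 2) (Fin 2) ℂ := (toL2 F K c₀).symm (LinearMap.adjoint (Qk F n K h c₀ cB U₀) (toL2B F n cB Y)) with hX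
  have hXeq : toL2 F K c₀ X = LinearMap.adjoint (Qk F n K h c₀ cB U₀) (toL2B F n cB Y) := LinearEquiv.apply_symm_apply _ _
  have hXb : ∀ bd, ‖X bd‖ ≤ CQ * (CK * ‖b‖) := fun bd => (hQa Y bd).trans (mul_le_mul_of_nonneg_left hYn hCQ)
  have hHT : HT F n K h c₀ cB a Δx U₀ (toL2B F n cB b) = GT F n K h c₀ cB a Δx U₀ (toL2 F K c₀ X) := by
    rw [HT_eq_comp hp, hXeq, hYeq]; rfl
  have main := hGx X (CQ * (CK * ‖b‖)) hXb
  simp only [hHT]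
  exact main.trans (le_of_eq (by ring))

/-! ## §3 ★★★ hGπ: the (115)-gradient row of `H_π = G_πQ_k†K_π⁻¹` -/

/-- ★★★ **hGπ-KNIT: THE Hπ-DOOR's GRADIENT LETTER FROM (∇π) AND THE TWO K-STOREY SUP LETTERS.**  With the letters of §1 and (Q†) `hQa`, (K1π) `hKinv` (the slot-`Δ_πᴾ` edition of §2 over §1):
`∀ b, ‖∇_{U₀}(toL2⁻¹(H_π(toL2B b)) ∘ bondEquiv⁻¹)‖ ≤ (BGπ·(CQ·CK))·‖b‖` — the member text of the `hGπ` letter of ✓`Prop7NormHpiOfKernel133.norm_Hπ_of_h133_of_gradFamily`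
([Balaban1985BackgroundPropagators] (3.133)₂ for the member's `H` (3.126), sup currency), with `BGπ` §1's constant.
[cite: Balaban1985BackgroundPropagators, (3.126) p.420, (3.130)–(3.133) pp.421–422, Thm 3.12 p.423; Balaban1985Variational, (45)–(46) p.285, (115)–(117) pp.294–295] -/
theorem gradient_row_HTpi_of_letters {α : ℝ} (U₀ : GaugeField (F.P K) 0 (Matrix.specialUnitaryGroup (Fin 2) ℂ)) (hreg : RegPr F n K α U₀) (ha : 0 ≤ a)
    (hp₀ : PosOnto F n K h c₀ cB a (DeltaEtaSlot F n K c₀) U₀) (hpπ : PosOnto F n K h c₀ cB a (DeltaPiSlotP F n K h c₀ cB a) U₀)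
    {BV BD C₁ C₂ C₃ BG BH : ℝ} (hBV : 0 ≤ BV) (hBD : 0 ≤ BD) (hC₁ : 0 ≤ C₁) (hC₂ : 0 ≤ C₂) (hC₃ : 0 ≤ C₃)
    (hV : ∀ (X : PBond (F.P K) 0 → Matrix (Fin 2) (Fin 2) ℂ) (s : ℝ), (∀ b, ‖X b‖ ≤ s) →
      ∀ b, ‖(toL2 F K c₀).symm (GT F n K h c₀ cB a (DeltaEtaSlot F n K c₀) U₀ (toL2 F K c₀ X)) b‖ ≤ BV * s)
    (hDiv : ∀ (X : PBond (F.P K) 0 → Matrix (Fin 2) (Fin 2) ℂ) (s : ℝ), (∀ b, ‖X b‖ ≤ s) →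
      ∀ x, ‖(toL2S F K c₀).symm (DstarL2 F n K c₀ U₀ (GT F n K h c₀ cB a (DeltaEtaSlot F n K c₀) U₀ (toL2 F K c₀ X))) x‖ ≤ BD * s)
    (hc1 : ∀ (v : Site (F.P K) 0 → Matrix (Fin 2) (Fin 2) ℂ) (m : ℝ), (∀ x, ‖v x‖ ≤ m) →
      ∀ x, ‖(toL2S F K c₀).symm (GprimeP F n K h c₀ cB a U₀ (RS F n K h c₀ cB U₀ (toL2S F K c₀ v))) x‖ ≤ C₁ * m)
    (hc2 : ∀ (v : Site (F.P K) 0 → Matrix (Fin 2) (Fin 2) ℂ) (m : ℝ), (∀ x, ‖v x‖ ≤ m) →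
      ∀ b, ‖(toL2 F K c₀).symm (DL2 F n K c₀ U₀ (GprimeP F n K h c₀ cB a U₀ (RS F n K h c₀ cB U₀ (toL2S F K c₀ v)))) b‖ ≤ C₂ * m)
    (hc3 : ∀ (v : Site (F.P K) 0 → Matrix (Fin 2) (Fin 2) ℂ) (m : ℝ), (∀ x, ‖v x‖ ≤ m) →
      ∀ x, ‖(toL2S F K c₀).symm (RS F n K h c₀ cB U₀ (GprimeP F n K h c₀ cB a U₀ (toL2S F K c₀ v))) x‖ ≤ C₃ * m)
    (hwin : 4 * α * C₁ * (BV + BD) + 12 * α * C₃ * (1 + C₂) * (1 + C₂ + 4 * α * C₁ * (BV + BD)) ≤ 1 / 2)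
    (hG0 : ∀ (X : PBond (F.P K) 0 → Matrix (Fin 2) (Fin 2) ℂ) (s : ℝ), (∀ b, ‖X b‖ ≤ s) →
      ‖nabla115 (((F.L : ℝ)⁻¹) ^ (K - n)) (bgOfCfg F K U₀)
          (fun q : Bond 3 (periodsT3 F K) => (toL2 F K c₀).symm (GT F n K h c₀ cB a (DeltaEtaSlot F n K c₀) U₀ (toL2 F K c₀ X)) ((bondEquiv F K).symm q))‖ ≤ BG * s)
    (hHD : ∀ (v : Site (F.P K) 0 → Matrix (Fin 2) (Fin 2) ℂ) (m : ℝ), (∀ x, ‖v x‖ ≤ m) →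
      ‖nabla115 (((F.L : ℝ)⁻¹) ^ (K - n)) (bgOfCfg F K U₀)
          (fun q : Bond 3 (periodsT3 F K) => (toL2 F K c₀).symm (DL2 F n K c₀ U₀ (GprimeP F n K h c₀ cB a U₀ (RS F n K h c₀ cB U₀
            (GprimeP F n K h c₀ cB a U₀ (toL2S F K c₀ v))))) ((bondEquiv F K).symm q))‖ ≤ BH * m)
    {CQ CK : ℝ} (hCQ : 0 ≤ CQ)
    (hQa : ∀ (Y : PBond (F.P n) 0 → Matrix (Fin 2) (Fin 2) ℂ) (bd : PBond (F.P K) 0),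
      ‖(toL2 F K c₀).symm (LinearMap.adjoint (Qk F n K h c₀ cB U₀) (toL2B F n cB Y)) bd‖ ≤ CQ * ‖Y‖)
    (hKinv : ∀ (b : PBond (F.P n) 0 → Matrix (Fin 2) (Fin 2) ℂ) (c : PBond (F.P n) 0),
      ‖(toL2B F n cB).symm (KinvT F n K h c₀ cB a (DeltaPiSlotP F n K h c₀ cB a) U₀ (toL2B F n cB b)) c‖ ≤ CK * ‖b‖)
    (b : PBond (F.P n) 0 → Matrix (Fin 2) (Fin 2) ℂ) :
    ‖nabla115 (((F.L : ℝ)⁻¹) ^ (K - n)) (bgOfCfg F K U₀)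
        (fun q : Bond 3 (periodsT3 F K) =>
          (toL2 F K c₀).symm (HT F n K h c₀ cB a (DeltaPiSlotP F n K h c₀ cB a) U₀ (toL2B F n cB b)) ((bondEquiv F K).symm q))‖
      ≤ ((BG * (1 + 8 * α * C₁ * (BV + BD) + 96 * α ^ 2 * C₁ * C₃ * (1 + C₂) * (BV + BD)) + BH * (24 * α * (1 + C₂) * (BV + BD))) * (CQ * CK)) * ‖b‖ :=
  gradient_row_HT_of_gradient_row U₀ _ hpπ hCQ
    (gradient_row_GTpi_of_letters U₀ hreg ha hp₀ hpπ hBV hBD hC₁ hC₂ hC₃ hV hDiv hc1 hc2 hc3 hwin hG0 hHD) hQa hKinv b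

end Summit.QuantumFields.YangMills.Theorems.Prop7GreenPiGradientRowOfLetters

end
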